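import Summits.KontsevichZagierPeriods.KontsevichZagierPeriods.Theses.FurushoPentagon
import Literature.NumberTheory.Transcendental.KZSemiCanonicalReductionProofs
import Literature.NumberTheory.Transcendental.KZProductIdeal
import Literature.NumberTheory.Transcendental.KZLogCalculusProofs

/-!
# `PentagonInKZ`, line `logfree-gauge-corner-flatness`: stub `stub_halfEdgeUniversal` — geometry tools

Support file (crux `PentagonInKZ`, stmt-KontsevichZagierPeriods-11348, route FurushoPentagon) for
the class-level composition formula `Φ = G₁(½)⁻¹ G₀(½)`: `halfEdgeUniversal_reflectPiece` — ONE
change-of-variables move carrying the piece `{1 > t₀ > ⋯ > t_{k-1} > ½ > t_k > ⋯ > 0}` of the MZV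
simplex (Kontsevich's integrand) onto the product of two half-simplices `{½ > s > ⋯ > 0}` with the
path integrands `∏ 1/(sᵢ - c)`, by the affine reflection `sᵢ = 1 - t_{k-1-i}` (`i < k`), an
involution with `|det| = 1`, up to an explicit sign; the product-form cells (semialgebraic, inside
the simplex, covering it off the null walls `{tᵢ = ½}`, disjoint); and `dissect`, iterated domain
additivity over such a family. Refs: Kontsevich–Zagier, *Periods* (2001), §1.2; Eie (2013), §1.1.
-/

noncomputable section

open Literature.NumberTheory.Transcendental MeasureTheory Set
open Literature.ModelTheory.ExponentialFields (IsSemialgebraic isSemialgebraic_setOf_eval_pos)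

namespace Summit.KontsevichZagierPeriods.FurushoPentagon.PentagonInKZ.HalfEdgeUniversal

/-! ## 1. Letter forms under the reflection `t ↦ 1 - t` -/

/-- `ω_ε(y) = (±1) · 1/((1 - y) - c_{¬ε})`: Kontsevich's form at `y` is, up to sign, the path form
of the exchanged letter at `1 - y` (`ω₀(y) = 1/y = -1/((1-y) - 1)`, `ω₁(y) = 1/(1-y)`).
[cite: Eie2013, §1.1] -/
theorem mzvForm_eq_sign_mul_reflect (c : Bool) (y : ℝ) :
    KZ.mzvForm c y = (if c then (1 : ℝ) else -1) * (1 / (1 - y - if (!c) then 1 else 0)) := by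
  cases c <;> simp [KZ.mzvForm]

/-- `ω_ε(x) = (∓1) · 1/(x - c_ε)`: `ω₀(x) = 1/x`, `ω₁(x) = 1/(1-x) = -1/(x-1)`. [folklore] -/
theorem mzvForm_eq_sign_mul (c : Bool) (x : ℝ) :
    KZ.mzvForm c x = (if c then (-1 : ℝ) else 1) * (1 / (x - if c then 1 else 0)) := by
  cases c
  · simp [KZ.mzvForm]
  · simp [KZ.mzvForm]
    rw [← inv_neg, neg_sub]

/-! ## 2. The reflection piece: one change-of-variables move -/

/-- **The reflection piece.** For a representation `R` on the product-form cell
`{1 > w₀ > ⋯ > w_{k-1} > ½} × {½ > w_k > ⋯ > w_{k+l-1} > 0}` with Kontsevich's integrand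
`∏ ω_{aᵢ}(wᵢ) ∏ ω_{bⱼ}(w_{k+j})`, representations `U`, `V` on the half-simplices `{½ > s₀ > ⋯ > 0}`
with the path integrands `∏ 1/(sᵢ - c(a'ᵢ))`, `a'ᵢ = ¬a_{k-1-i}`, `∏ 1/(sⱼ - c(bⱼ))` (`c(0) = 0`,
`c(1) = 1`), and any `R'` on `U.domain × V.domain` with integrand `ε · (f_U ⊗ f_V)`,
`ε = ∏ᵢ (±1)(aᵢ) ∏ⱼ (∓1)(bⱼ)`: `[R] - [R'] ∈ KZ.relations`, by the affine reflection
`sᵢ = 1 - w_{k-1-i}`, `s_{k+j} = w_{k+j}` (a `ℚ`-polynomial involution, `|det| = 1`, rule (2)).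
[cite: KontsevichZagier2001, §1.2 rule (2)] -/
theorem reflect_piece {k l : ℕ} (a : Fin k → Bool) (b : Fin l → Bool) (a' : Fin k → Bool)
    (ha' : ∀ i, a' i = !a (Fin.rev i)) (R : KZ.IntegralRep (k + l))
    (hRd : R.domain = {w | (∀ i, 1 / 2 < w (Fin.castAdd l i) ∧ w (Fin.castAdd l i) < 1) ∧
      StrictAnti (fun i => w (Fin.castAdd l i)) ∧
      (∀ j, 0 < w (Fin.natAdd k j) ∧ w (Fin.natAdd k j) < 1 / 2) ∧
      StrictAnti (fun j => w (Fin.natAdd k j))})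
    (hRi : EqOn R.integrand (fun w => (∏ i, KZ.mzvForm (a i) (w (Fin.castAdd l i))) *
      ∏ j, KZ.mzvForm (b j) (w (Fin.natAdd k j))) R.domain)
    (U : KZ.IntegralRep k) (hUd : U.domain = {s | (∀ i, 0 < s i ∧ s i < 1 / 2) ∧ StrictAnti s})
    (hUi : EqOn U.integrand (fun s => ∏ i, 1 / (s i - if a' i then 1 else 0)) U.domain)
    (V : KZ.IntegralRep l) (hVd : V.domain = {s | (∀ j, 0 < s j ∧ s j < 1 / 2) ∧ StrictAnti s})
    (hVi : EqOn V.integrand (fun s => ∏ j, 1 / (s j - if b j then 1 else 0)) V.domain)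
    (ε : ℝ) (hε : ε = (∏ i, if a i then (1 : ℝ) else -1) * ∏ j, if b j then (-1 : ℝ) else 1)
    (R' : KZ.IntegralRep (k + l)) (hR'd : R'.domain = KZ.IntegralRep.prodDomain U V)
    (hR'i : EqOn R'.integrand (fun w => ε * KZ.IntegralRep.prodFun U V w) R'.domain) :
    KZ.of R - KZ.of R' ∈ KZ.relations := by
  -- the linear part of the reflection, the reflection, and their involutivity
  set L : (Fin (k + l) → ℝ) →L[ℝ] (Fin (k + l) → ℝ) := ContinuousLinearMap.pi
    (Fin.addCases (motive := fun _ => (Fin (k + l) → ℝ) →L[ℝ] ℝ)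
      (fun i => -ContinuousLinearMap.proj (Fin.castAdd l (Fin.rev i)))
      (fun j => ContinuousLinearMap.proj (Fin.natAdd k j))) with hL
  have hL1 : ∀ w i, L w (Fin.castAdd l i) = -w (Fin.castAdd l (Fin.rev i)) := by
    intro w i; simp [hL]
  have hL2 : ∀ w j, L w (Fin.natAdd k j) = w (Fin.natAdd k j) := by
    intro w j; simp [hL]
  set p₀ : Fin (k + l) → ℝ := Fin.append (fun _ : Fin k => (1 : ℝ)) (fun _ : Fin l => 0) with hp₀
  set Ψ : (Fin (k + l) → ℝ) → (Fin (k + l) → ℝ) := fun w => p₀ + L w with hΨ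
  have hΨ1 : ∀ w i, Ψ w (Fin.castAdd l i) = 1 - w (Fin.castAdd l (Fin.rev i)) := by
    intro w i; simp [hΨ, hp₀, hL1, sub_eq_add_neg]
  have hΨ2 : ∀ w j, Ψ w (Fin.natAdd k j) = w (Fin.natAdd k j) := by
    intro w j; simp [hΨ, hp₀, hL2]
  have hLL : ∀ w, L (L w) = w := by
    intro w; funext i
    induction i using Fin.addCases with
    | left i => rw [hL1, hL1, Fin.rev_rev, neg_neg]
    | right j => rw [hL2, hL2]
  have hΨΨ : ∀ w, Ψ (Ψ w) = w := by
    intro w; funext i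
    induction i using Fin.addCases with
    | left i => rw [hΨ1, hΨ1, Fin.rev_rev]; ring
    | right j => rw [hΨ2, hΨ2]
  have hdet : |L.det| = 1 := by
    have h2 : L.comp L = ContinuousLinearMap.id ℝ _ := by
      ext w i
      simp [hLL]
    have h3 : L.det * L.det = 1 := by
      have := congrArg ContinuousLinearMap.det h2
      simpa [ContinuousLinearMap.det, LinearMap.det_comp] using this
    rcases mul_self_eq_one_iff.mp h3 with h | h <;> simp [h]
  -- the reflection exchanges the cell and the product of the half-simplices
  have hM1 : ∀ z ∈ R.domain, Ψ z ∈ KZ.IntegralRep.prodDomain U V := by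
    intro z hz
    rw [hRd] at hz
    obtain ⟨hA, hAa, hB, hBa⟩ := hz
    rw [KZ.IntegralRep.mem_prodDomain, hUd, hVd]
    simp only [mem_setOf_eq, hΨ1, hΨ2]
    refine ⟨⟨fun i => ⟨?_, ?_⟩, fun i j hij => ?_⟩, fun j => hB j, hBa⟩
    · linarith [(hA (Fin.rev i)).2]
    · linarith [(hA (Fin.rev i)).1]
    · have := hAa (Fin.rev_lt_rev.mpr hij)
      dsimp only at this ⊢
      linarith
  have hM2 : ∀ w ∈ KZ.IntegralRep.prodDomain U V, Ψ w ∈ R.domain := by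
    intro w hw
    rw [KZ.IntegralRep.mem_prodDomain, hUd, hVd] at hw
    simp only [mem_setOf_eq] at hw
    obtain ⟨⟨hA, hAa⟩, hB, hBa⟩ := hw
    rw [hRd]
    simp only [mem_setOf_eq, hΨ1, hΨ2]
    refine ⟨fun i => ⟨?_, ?_⟩, fun i j hij => ?_, fun j => hB j, hBa⟩
    · linarith [(hA (Fin.rev i)).2]
    · linarith [(hA (Fin.rev i)).1]
    · have := hAa (Fin.rev_lt_rev.mpr hij)
      dsimp only at this ⊢
      linarith
  refine KZ.changeOfVariablesRel_subset_relations
    ⟨k + l, R, R', Ψ, fun _ => L, ?_, ?_, ?_, ?_, ?_, rfl⟩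
  · -- a `ℚ`-polynomial map
    refine (isSemialgebraicMapOn_aeval R.isSemialgebraic_domain
      (Fin.addCases (motive := fun _ => MvPolynomial (Fin (k + l)) ℚ)
        (fun i => 1 - MvPolynomial.X (Fin.castAdd l (Fin.rev i)))
        (fun j => MvPolynomial.X (Fin.natAdd k j)))).congr fun w _ => ?_
    funext i
    induction i using Fin.addCases with
    | left i => simp [hΨ1]
    | right j => simp [hΨ2]
  · exact fun x _ => ((L.hasFDerivAt).const_add p₀).hasFDerivWithinAt
  · intro z₁ _ z₂ _ h
    have := congrArg Ψ h
    rwa [hΨΨ, hΨΨ] at this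
  · rw [hR'd]
    ext w
    exact ⟨fun hw => ⟨Ψ w, hM2 w hw, hΨΨ w⟩, fun ⟨z, hz, hzw⟩ => hzw ▸ hM1 z hz⟩
  · intro z hz
    have hz' := hM1 z hz
    show R.integrand z = R'.integrand (Ψ z) * |L.det|
    rw [hR'i (by rw [hR'd]; exact hz'), hdet, mul_one]
    dsimp only
    rw [KZ.IntegralRep.prodFun_apply]
    have hzU : (fun i => Ψ z (Fin.castAdd l i)) ∈ U.domain :=
      ((KZ.IntegralRep.mem_prodDomain U V _).mp hz').1
    have hzV : (fun j => Ψ z (Fin.natAdd k j)) ∈ V.domain :=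
      ((KZ.IntegralRep.mem_prodDomain U V _).mp hz').2
    rw [hUi hzU, hVi hzV, hRi hz, hε]
    simp only [hΨ1, hΨ2]
    rw [← Equiv.prod_comp Fin.revPerm (fun i => KZ.mzvForm (a i) (z (Fin.castAdd l i))),
      ← Equiv.prod_comp Fin.revPerm (fun i => if a i then (1 : ℝ) else -1)]
    simp only [Fin.revPerm_apply]
    have key1 : ∀ i, KZ.mzvForm (a (Fin.rev i)) (z (Fin.castAdd l (Fin.rev i))) =
        (if a (Fin.rev i) then (1 : ℝ) else -1) *
          (1 / (1 - z (Fin.castAdd l (Fin.rev i)) - if a' i then 1 else 0)) := by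
      intro i
      rw [ha', mzvForm_eq_sign_mul_reflect]
    simp only [key1, mzvForm_eq_sign_mul (b _), Finset.prod_mul_distrib]
    ring

/-! ## 3. The product-form cells -/

/-- A box-constrained ordered simplex `{lo < sᵢ < hi, s strictly decreasing}` with rational bounds
is `ℚ`-semialgebraic. [folklore] -/
theorem isSemialgebraic_boxSimplex (k : ℕ) {lo hi : ℝ} (hlo : ∃ q : ℚ, (q : ℝ) = lo)
    (hhi : ∃ q : ℚ, (q : ℝ) = hi) :
    IsSemialgebraic ℚ {s : Fin k → ℝ | (∀ i, lo < s i ∧ s i < hi) ∧ StrictAnti s} := by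
  obtain ⟨lo, rfl⟩ := hlo
  obtain ⟨hi, rfl⟩ := hhi
  have h1 : IsSemialgebraic ℚ {s : Fin k → ℝ | ∀ i, (lo : ℝ) < s i ∧ s i < hi} := by
    have : {s : Fin k → ℝ | ∀ i, (lo : ℝ) < s i ∧ s i < hi} = ⋂ i ∈ (Finset.univ : Finset (Fin k)),
        ({s | 0 < MvPolynomial.aeval s (MvPolynomial.X i - MvPolynomial.C lo : MvPolynomial (Fin k) ℚ)} ∩
          {s | 0 < MvPolynomial.aeval s (MvPolynomial.C hi - MvPolynomial.X i : MvPolynomial (Fin k) ℚ)}) := by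
      ext s
      simp [sub_pos]
    rw [this]
    exact IsSemialgebraic.biInter _ _ fun i _ =>
      (isSemialgebraic_setOf_eval_pos _).inter (isSemialgebraic_setOf_eval_pos _)
  have h2 : IsSemialgebraic ℚ {s : Fin k → ℝ | StrictAnti s} := by
    have : {s : Fin k → ℝ | StrictAnti s} = ⋂ p ∈ (Finset.univ.filter fun p : Fin k × Fin k =>
        p.1 < p.2), {s | 0 < MvPolynomial.aeval s
          (MvPolynomial.X p.1 - MvPolynomial.X p.2 : MvPolynomial (Fin k) ℚ)} := by
      ext s
      simp only [mem_setOf_eq, Finset.mem_filter, Finset.mem_univ, true_and, mem_iInter,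
        map_sub, MvPolynomial.aeval_X, sub_pos, Prod.forall]
      exact ⟨fun h a b hab => h hab, fun h a b hab => h a b hab⟩
    rw [this]
    exact IsSemialgebraic.biInter _ _ fun p _ => isSemialgebraic_setOf_eval_pos _
  exact h1.inter h2

/-- The product-form cell `{1 > w₀ > ⋯ > w_{k-1} > ½} × {½ > w_k > ⋯ > w_{k+l-1} > 0}` is
`ℚ`-semialgebraic. [folklore] -/
theorem isSemialgebraic_cell (k l : ℕ) :
    IsSemialgebraic ℚ {w : Fin (k + l) → ℝ | (∀ i, 1 / 2 < w (Fin.castAdd l i) ∧ w (Fin.castAdd l i) < 1) ∧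
      StrictAnti (fun i => w (Fin.castAdd l i)) ∧
      (∀ j, 0 < w (Fin.natAdd k j) ∧ w (Fin.natAdd k j) < 1 / 2) ∧
      StrictAnti (fun j => w (Fin.natAdd k j))} := by
  have hA := isSemialgebraic_boxSimplex k (lo := 1 / 2) (hi := 1) ⟨1 / 2, by norm_num⟩ ⟨1, by norm_num⟩
  have hB := isSemialgebraic_boxSimplex l (lo := 0) (hi := 1 / 2) ⟨0, by norm_num⟩ ⟨1 / 2, by norm_num⟩
  convert (hA.preimage_comp (Fin.castAdd l)).inter (hB.preimage_comp (Fin.natAdd k)) using 1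
  ext w
  simp only [mem_setOf_eq, mem_inter_iff, mem_preimage, Function.comp_def, and_assoc]

/-- A value-preserving `e : Fin m ≃ Fin (k + l)` has a value-preserving inverse. [folklore] -/
theorem val_symm_eq {m k l : ℕ} (e : Fin m ≃ Fin (k + l)) (he : ∀ i, (e i : ℕ) = i)
    (j : Fin (k + l)) : ((e.symm j : Fin m) : ℕ) = j := by
  simpa using (he (e.symm j)).symm

/-- The preimage of a product-form cell under a value-preserving relabelling lies in the open
ordered simplex `{1 > t₀ > ⋯ > t_{m-1} > 0}`. [folklore] -/
theorem preimage_cell_subset_simplex {m k l : ℕ} (e : Fin m ≃ Fin (k + l))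
    (he : ∀ i, (e i : ℕ) = i) :
    {t : Fin m → ℝ | (fun j => t (e.symm j)) ∈ {w : Fin (k + l) → ℝ |
      (∀ i, 1 / 2 < w (Fin.castAdd l i) ∧ w (Fin.castAdd l i) < 1) ∧
      StrictAnti (fun i => w (Fin.castAdd l i)) ∧
      (∀ j, 0 < w (Fin.natAdd k j) ∧ w (Fin.natAdd k j) < 1 / 2) ∧
      StrictAnti (fun j => w (Fin.natAdd k j))}} ⊆
    {t | (∀ i, 0 < t i) ∧ (∀ i, t i < 1) ∧ StrictAnti t} := by
  have hm : m = k + l := by simpa using Fintype.card_congr e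
  have hval := val_symm_eq e he
  intro t ht
  simp only [mem_setOf_eq] at ht
  obtain ⟨hA, hAa, hB, hBa⟩ := ht
  -- every coordinate is a first-block or a second-block coordinate
  have hfst : ∀ i : Fin m, ∀ hi : (i : ℕ) < k, e.symm (Fin.castAdd l ⟨i, hi⟩) = i :=
    fun i hi => Fin.ext (by rw [hval]; rfl)
  have hsnd : ∀ i : Fin m, ∀ hi : k ≤ (i : ℕ),
      e.symm (Fin.natAdd k ⟨i - k, by omega⟩) = i :=
    fun i hi => Fin.ext (by rw [hval]; simp; omega)
  have hcoord : ∀ i : Fin m, 0 < t i ∧ t i < 1 ∧ ((i : ℕ) < k → 1 / 2 < t i) ∧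
      (k ≤ (i : ℕ) → t i < 1 / 2) := by
    intro i
    by_cases hi : (i : ℕ) < k
    · have h := hA ⟨i, hi⟩
      rw [hfst i hi] at h
      exact ⟨by linarith [h.1], h.2, fun _ => h.1, fun h' => absurd hi (by omega)⟩
    · push Not at hi
      have h := hB ⟨i - k, by omega⟩
      rw [hsnd i hi] at h
      exact ⟨h.1, by linarith [h.2], fun h' => absurd h' (by omega), fun _ => h.2⟩
  refine ⟨fun i => (hcoord i).1, fun i => (hcoord i).2.1, fun i i' hii' => ?_⟩
  have hlt : (i : ℕ) < i' := hii'
  by_cases hi' : (i' : ℕ) < k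
  · have hi : (i : ℕ) < k := by omega
    have h := hAa (show (⟨i, hi⟩ : Fin k) < ⟨i', hi'⟩ from hlt)
    dsimp only at h
    rwa [hfst i hi, hfst i' hi'] at h
  · push Not at hi'
    by_cases hi : (i : ℕ) < k
    · linarith [(hcoord i).2.2.1 hi, (hcoord i').2.2.2 hi']
    · push Not at hi
      have h := hBa (show (⟨i - k, by omega⟩ : Fin l) < ⟨i' - k, by omega⟩ by
        rw [Fin.lt_def]; dsimp only; omega)
      dsimp only at h
      rwa [hsnd i hi, hsnd i' hi'] at h

/-- **Covering.** A point of the open ordered simplex off the walls `{tᵢ = ½}` lies in the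
(preimage of the) product-form cell whose first block has size `k = #{i | tᵢ > ½}`: since `t` is
decreasing, `{i | tᵢ > ½}` is the initial segment `{i < k}`. [folklore] -/
theorem mem_preimage_cell {m : ℕ} {t : Fin m → ℝ}
    (ht : t ∈ {t : Fin m → ℝ | (∀ i, 0 < t i) ∧ (∀ i, t i < 1) ∧ StrictAnti t})
    (hw : ∀ i, t i ≠ 1 / 2) {k l : ℕ} (e : Fin m ≃ Fin (k + l)) (he : ∀ i, (e i : ℕ) = i)
    (hk : k = (Finset.univ.filter fun i => 1 / 2 < t i).card) :
    (fun j => t (e.symm j)) ∈ {w : Fin (k + l) → ℝ |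
      (∀ i, 1 / 2 < w (Fin.castAdd l i) ∧ w (Fin.castAdd l i) < 1) ∧
      StrictAnti (fun i => w (Fin.castAdd l i)) ∧
      (∀ j, 0 < w (Fin.natAdd k j) ∧ w (Fin.natAdd k j) < 1 / 2) ∧
      StrictAnti (fun j => w (Fin.natAdd k j))} := by
  classical
  obtain ⟨h0, h1, hanti⟩ := ht
  have hval := val_symm_eq e he
  set A := Finset.univ.filter fun i => 1 / 2 < t i with hAdef
  -- `A` is the initial segment `{i < k}`
  have hkey : ∀ i : Fin m, 1 / 2 < t i ↔ (i : ℕ) < k := by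
    intro i
    constructor
    · intro hi
      have hsub : Finset.Iic i ⊆ A := by
        intro j hj
        rw [Finset.mem_Iic] at hj
        rw [hAdef, Finset.mem_filter]
        refine ⟨Finset.mem_univ _, ?_⟩
        rcases hj.lt_or_eq with hj | rfl
        · exact hi.trans (hanti hj)
        · exact hi
      have := Finset.card_le_card hsub
      rw [Fin.card_Iic, ← hk] at this
      omega
    · intro hi
      by_contra hti
      have hsub : A ⊆ Finset.Iio i := by
        intro j hj
        rw [hAdef, Finset.mem_filter] at hj
        rw [Finset.mem_Iio]
        by_contra hji
        push Not at hji
        rcases hji.lt_or_eq with hji | rfl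
        · exact hti (hj.2.trans (hanti hji))
        · exact hti hj.2
      have := Finset.card_le_card hsub
      rw [Fin.card_Iio, ← hk] at this
      omega
  simp only [mem_setOf_eq]
  refine ⟨fun i => ⟨?_, h1 _⟩, fun i i' hii' => ?_, fun j => ⟨h0 _, ?_⟩, fun j j' hjj' => ?_⟩
  · exact (hkey _).mpr (by rw [hval]; exact i.isLt)
  · refine hanti ?_
    rw [Fin.lt_def, hval, hval]
    exact hii'
  · have hle : ¬ (1 / 2 < t (e.symm (Fin.natAdd k j))) := by
      rw [hkey, hval, not_lt]; exact Nat.le_add_right _ _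
    exact lt_of_le_of_ne (not_lt.mp hle) (hw _)
  · refine hanti ?_
    rw [Fin.lt_def, hval, hval]
    simpa using hjj'

/-- **Disjointness.** The preimages of product-form cells with different first-block sizes are
disjoint (the coordinate `t_k` would be both `< ½` and `> ½`). [folklore] -/
theorem not_mem_preimage_cell_of_lt {m k l k' l' : ℕ} (e : Fin m ≃ Fin (k + l))
    (he : ∀ i, (e i : ℕ) = i) (e' : Fin m ≃ Fin (k' + l')) (he' : ∀ i, (e' i : ℕ) = i)
    (hkk' : k < k') (t : Fin m → ℝ)
    (h : (fun j => t (e.symm j)) ∈ {w : Fin (k + l) → ℝ |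
      (∀ i, 1 / 2 < w (Fin.castAdd l i) ∧ w (Fin.castAdd l i) < 1) ∧
      StrictAnti (fun i => w (Fin.castAdd l i)) ∧
      (∀ j, 0 < w (Fin.natAdd k j) ∧ w (Fin.natAdd k j) < 1 / 2) ∧
      StrictAnti (fun j => w (Fin.natAdd k j))})
    (h' : (fun j => t (e'.symm j)) ∈ {w : Fin (k' + l') → ℝ |
      (∀ i, 1 / 2 < w (Fin.castAdd l' i) ∧ w (Fin.castAdd l' i) < 1) ∧
      StrictAnti (fun i => w (Fin.castAdd l' i)) ∧
      (∀ j, 0 < w (Fin.natAdd k' j) ∧ w (Fin.natAdd k' j) < 1 / 2) ∧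
      StrictAnti (fun j => w (Fin.natAdd k' j))}) : False := by
  have hm : m = k + l := by simpa using Fintype.card_congr e
  have hl : 0 < l := by have := Fintype.card_congr e'; simp at this; omega
  simp only [mem_setOf_eq] at h h'
  have h1 := (h.2.2.1 ⟨0, hl⟩).2
  have h2 := (h'.1 ⟨k, hkk'⟩).1
  have heq : e.symm (Fin.natAdd k ⟨0, hl⟩) = e'.symm (Fin.castAdd l' ⟨k, hkk'⟩) :=
    Fin.ext (by rw [val_symm_eq e he, val_symm_eq e' he']; simp)
  rw [heq] at h1
  linarith

/-! ## 4. Dissection of a simplex representation off the null walls `{tᵢ = ½}` -/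

/-- **Dissection at `½`.** A representation on the open ordered simplex and a finite family of
semialgebraic cells `D k ⊆` the simplex (`k ≤ m`), pairwise disjoint and covering the simplex off
the null walls `{tᵢ = ½}`: `[Q] − Σ_k [Q|_{D k}] ∈ KZ.relations` (iterated domain additivity).
[cite: KontsevichZagier2001, §1.2 rule (1)] -/
theorem dissect {m : ℕ} (Q : KZ.IntegralRep m) (D : ℕ → Set (Fin m → ℝ))
    (hDs : ∀ k, IsSemialgebraic ℚ (D k)) (hDsub : ∀ k, D k ⊆ Q.domain)
    (hcov : ∀ t ∈ Q.domain, (∀ i, t i ≠ 1 / 2) → ∃ k ∈ Finset.range (m + 1), t ∈ D k)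
    (hdisj : ∀ k k', k < k' → k' ≤ m → ∀ t, t ∈ D k → t ∈ D k' → False) :
    KZ.of Q - ∑ k ∈ Finset.range (m + 1), KZ.of (Q.restrict (D k) (hDs k) (hDsub k)) ∈
      KZ.relations := by
  refine KZ.of_sub_sum_of_mem_relations (Finset.range (m + 1)) Q
    (fun k => Q.restrict (D k) (hDs k) (hDsub k)) (fun k _ => ?_) (fun k _ x _ => rfl) ?_ ?_
  · rw [KZ.IntegralRep.domain_restrict, Set.sdiff_eq_empty.mpr (hDsub k), measure_empty]
  · have hnull : volume (⋃ i : Fin m, {t : Fin m → ℝ | t i = 1 / 2}) = 0 :=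
      measure_iUnion_null fun i => by
        rw [MeasureTheory.volume_pi]
        exact Measure.pi_hyperplane _ i _
    refine measure_mono_null (fun t ht => ?_) hnull
    obtain ⟨htQ, htU⟩ := ht
    simp only [mem_iUnion, mem_setOf_eq]
    by_contra hne
    push Not at hne
    obtain ⟨k, hk, htk⟩ := hcov t htQ hne
    exact htU (mem_iUnion₂.mpr ⟨k, hk, htk⟩)
  · intro k hk k' hk' hne
    rw [Finset.coe_range, mem_Iio] at hk hk'
    have hempty : D k ∩ D k' = ∅ := by
      ext t
      simp only [mem_inter_iff, mem_empty_iff_false, iff_false, not_and]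
      intro ht ht'
      rcases lt_or_gt_of_ne hne with hlt | hlt
      · exact hdisj k k' hlt (by omega) t ht ht'
      · exact hdisj k' k hlt (by omega) t ht' ht
    show volume (D k ∩ D k') = 0
    rw [hempty, measure_empty]

end Summit.KontsevichZagierPeriods.FurushoPentagon.PentagonInKZ.HalfEdgeUniversal

namespace Summit.KontsevichZagierPeriods.FurushoPentagon.PentagonInKZ

/-- **Registered sub-stub `halfEdgeUniversal_reflectPiece`** of `stub_halfEdgeUniversal`: the
reflection piece as one change-of-variables move (`HalfEdgeUniversal.reflect_piece`).
[cite: KontsevichZagier2001, §1.2 rule (2)] -/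
theorem halfEdgeUniversal_reflectPiece :
    ∀ {k l : ℕ} (a : Fin k → Bool) (b : Fin l → Bool) (c : Fin k → Bool), (∀ i, c i = !a (Fin.rev i)) → ∀ (R : KZ.IntegralRep (k + l)), R.domain = {w | (∀ i, 1 / 2 < w (Fin.castAdd l i) ∧ w (Fin.castAdd l i) < 1) ∧ StrictAnti (fun i => w (Fin.castAdd l i)) ∧ (∀ j, 0 < w (Fin.natAdd k j) ∧ w (Fin.natAdd k j) < 1 / 2) ∧ StrictAnti (fun j => w (Fin.natAdd k j))} → Set.EqOn R.integrand (fun w => (∏ i, KZ.mzvForm (a i) (w (Fin.castAdd l i))) * ∏ j, KZ.mzvForm (b j) (w (Fin.natAdd k j))) R.domain → ∀ (U : KZ.IntegralRep k), U.domain = {s | (∀ i, 0 < s i ∧ s i < 1 / 2) ∧ StrictAnti s} → Set.EqOn U.integrand (fun s => ∏ i, 1 / (s i - if c i then 1 else 0)) U.domain → ∀ (V : KZ.IntegralRep l), V.domain = {s | (∀ j, 0 < s j ∧ s j < 1 / 2) ∧ StrictAnti s} → Set.EqOn V.integrand (fun s => ∏ j, 1 / (s j - if b j then 1 else 0)) V.domain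 → ∀ (ε : ℝ), ε = (∏ i, if a i then (1 : ℝ) else -1) * (∏ j, if b j then (-1 : ℝ) else 1) → ∀ (T : KZ.IntegralRep (k + l)), T.domain = KZ.IntegralRep.prodDomain U V → Set.EqOn T.integrand (fun w => ε * KZ.IntegralRep.prodFun U V w) T.domain → KZ.of R - KZ.of T ∈ KZ.relations :=
  fun a b c hc R hRd hRi U hUd hUi V hVd hVi ε hε T hTd hTi =>
    HalfEdgeUniversal.reflect_piece a b c hc R hRd hRi U hUd hUi V hVd hVi ε hε T hTd hTi

end Summit.KontsevichZagierPeriods.FurushoPentagon.PentagonInKZ
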